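import Mathlib.Tactic

/-!
# Eigenclass live law of the W2 cusp-door toy rung (pub-hsemireg, W2 seat w2-t1-1)

Kernel transcription of the OPTIMISATION STEP of THEOREM (41-L-CLOSED) of the record memo
`widen/W2/w2t11/LIVELAW-w2t11g22.md` (w2-t1-1 gen 22), which closes the conjectural live law (41-L) of
`ROWUNIV3-w2t11g21.md` §1: on the eigenclass `(1,1)`-families of the with-sections floor model (τ ∈ {ew, ew2},
pencil j, one feeder class per free pencil, `s_b = u s_a + v`) the live system is LIVE iff
`N(s_a - s_b) < 1`, and then `sup m' = (1 - N(s_a - s_b)) / 3`, attained with a rank-one `H̄` (one sheet class).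
LINEAGE SIDE (not formalised; symbolic ×1 by `livelaw/live41L_symbolic.py`, kit j227829, output sha256/16 printed in
the memo; numerically ×2 by `rowuniv_check.live_exact` on 6 × 127 family rows): per pencil the 12 rational live
equations in `w' = (m', n_a, n_b, h11, h22, α, β)` (`d = 1`, `h12 = α + β ω̄`) have CONSTANT rank 6 and their solution
set on the family, in the rational coordinates `s_a = p + q ω`, is the LINE
`m' = t, n_a = n_b = T(p,q), h11 = ℓ₁(p,q) - t, h22 = ℓ₂(p,q) - t, (α, β)` affine in `t`, with the explicit data below
(four distinct systems: pencils 1 and 3 of each eigenclass share theirs).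
WHAT IS CHECKED HERE (explicit polynomial statements, no definitions), for each system:
* `det`: `h11 h22 - (α² - α β + β²) = T - t` — the PSD determinant of `H̄(t)` is LINEAR in `t`;
* `h11_at_T`, `h22_at_T`: at `t = T` the diagonal of `H̄` consists of the norm forms `N(s_a - s(f_i))` of the
  distances to two format classes; `T_eq`: `3 T = 1 - Ns` with `Ns` the printed `N(s_a - s_b)`; `Ns_eq`: `Ns` is the
  coordinate form of `3 s s̄ - P̄ s - P s̄ + v v̄` (`P = 3 s⋆`), the polynomial of
  `EigenclassPartnerIdentities.normDiff_*` (needs `ω² + ω + 1 = 0`);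
* over a linear ordered field: `bound` (every `t` with `det H̄(t) ≥ 0` has `t ≤ T`), `attained` (`t = T` satisfies
  `h11, h22 ≥ 0`, `det H̄ = 0`), `live_iff` (a feasible `t > 0` with `n_a = n_b = T ≥ 0` exists iff `0 < T`) and
  `mprime_max` (feasible ⇒ `m' ≤ T`, and `T` is feasible when `0 ≤ T`): `sup m' = T = (1 - N(s_a - s_b))/3`.
No geometry and no LP is formalised; the identification of these polynomials with the lineage's live system is the
memo's (Python, exact).  RECORD ONLY; W2 counts 0 ∕ 0 ∕ 0 unchanged.  Honest framing: nothing here says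
HC / HC_CM / HC_AV is proved.
-/

namespace Summit.Ventures.HSemireg.EigenclassLiveLaw

variable {R : Type*} [CommRing R]

/-- The norm form `x² - x y + y²` (= `N(x + y ω)`) is nonnegative over a linear ordered field. -/
theorem normForm_nonneg {F : Type*} [Field F] [LinearOrder F] [IsStrictOrderedRing F] (x y : F) :
    0 ≤ x ^ 2 - x * y + y ^ 2 := by
  nlinarith [sq_nonneg (2 * x - y), sq_nonneg y]

/-! ## System `ew_13` (τ = ew, pencils 1 and 3): `T = -q ^ 2 + p * q - p ^ 2 + 2 * q + 3 * p - 6`, `h11 = p - 2 - t`, `h22 = q - p + 1 - t`, `α = q - 2`, `β = t`. -/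

/-- (41-L-CLOSED, ew_13) `det H̄(t) = h11 h22 - (α² - αβ + β²) = T - t`: linear in `t`. -/
theorem det_ew_13 (p q t : R) :
    (p - 2 - t) * (q - p + 1 - t) - ((q - 2) ^ 2 - (q - 2) * (t) + (t) ^ 2) = (-q ^ 2 + p * q
    - p ^ 2 + 2 * q + 3 * p - 6) - t := by
  ring

/-- (41-L-CLOSED, ew_13) at `t = T`: `h11 = N(s_a - s(f0))`, `s(f0) = 2 + 2 ω` (τ = ew). -/
theorem h11_at_T_ew_13 (p q : R) :
    (p - 2) - (-q ^ 2 + p * q - p ^ 2 + 2 * q + 3 * p - 6) = (p - 2) ^ 2 - (p - 2) * (q - 2) + (q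
    - 2) ^ 2 := by
  ring

/-- (41-L-CLOSED, ew_13) at `t = T`: `h22 = N(s_a - s(f2))`, `s(f2) = 3 + 2 ω` (τ = ew). -/
theorem h22_at_T_ew_13 (p q : R) :
    (q - p + 1) - (-q ^ 2 + p * q - p ^ 2 + 2 * q + 3 * p - 6) = (p - 3) ^ 2 - (p - 3) * (q - 2)
    + (q - 2) ^ 2 := by
  ring

/-- (41-L, τ = ew) `3 T = 1 - Ns` with `Ns = N(s_a - s_b)` as printed, and `T = 1/3 - N(s_a - s⋆)`, `s⋆ = 8/3 + 7/3 ω`. -/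
theorem T_eq_ew (p q : R) :
    3 * (-q ^ 2 + p * q - p ^ 2 + 2 * q + 3 * p - 6) = 1 - (3 * q ^ 2 - 3 * p * q + 3 * p ^ 2
    - 6 * q - 9 * p + 19) := by
  ring

/-- (41-L, τ = ew) over a field of characteristic ≠ 3: `T = 1/3 - N(s_a - s⋆)` in coordinates. -/
theorem T_eq_third_sub_norm_ew {F : Type*} [Field F] [LinearOrder F] [IsStrictOrderedRing F] (p q : F) :
    (-q ^ 2 + p * q - p ^ 2 + 2 * q + 3 * p - 6 : F) = 1 / 3 - ((p - 8 / 3) ^ 2 - (p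
    - 8 / 3) * (q - 7 / 3) + (q - 7 / 3) ^ 2) := by
  have h3 : (3 : F) ≠ 0 := by norm_num
  field_simp
  ring

/-- (41-L ↔ 41-EW, ew_13) with `s = p + q ω`, `s̄ = p + q ω²`, `P = 3 s⋆ = 8 + 7 ω`, `v v̄ = 19`: the printed `Ns` is the
coordinate form of `3 s s̄ - P̄ s - P s̄ + v v̄ = ((1-u)s - v)((1-ū)s̄ - v̄)` (`EigenclassPartnerIdentities.normDiff_ew_13`). -/
theorem Ns_eq_ew_13 (ω p q : R) (hω : ω ^ 2 + ω + 1 = 0) :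
    3 * ((p + q * ω) * (p + q * ω ^ 2)) - (8 + 7 * ω ^ 2) * (p + q * ω) - (8 + 7 * ω) * (p
    + q * ω ^ 2) + 19
      = 3 * q ^ 2 - 3 * p * q + 3 * p ^ 2 - 6 * q - 9 * p + 19 := by
  linear_combination (3 * ω * q ^ 2 - 14 * ω * q + 3 * p * q - 3 * q ^ 2 - 7 * p + 6 * q) * hω

/-- (41-L-CLOSED, ew_13) BOUND: every `t` with `det H̄(t) ≥ 0` has `m' = t ≤ T`. -/
theorem bound_ew_13 {F : Type*} [Field F] [LinearOrder F] [IsStrictOrderedRing F] (p q t : F)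
    (hdet : 0 ≤ (p - 2 - t) * (q - p + 1 - t) - ((q - 2) ^ 2 - (q - 2) * (t) + (t) ^ 2)) :
    t ≤ -q ^ 2 + p * q - p ^ 2 + 2 * q + 3 * p - 6 := by
  have h := det_ew_13 p q t
  linarith

/-- (41-L-CLOSED, ew_13) ATTAINED: at `t = T`, `h11 ≥ 0`, `h22 ≥ 0` and `det H̄ = 0` (rank-one `H̄`: one sheet class). -/
theorem attained_ew_13 {F : Type*} [Field F] [LinearOrder F] [IsStrictOrderedRing F] (p q : F) :
    0 ≤ (p - 2) - (-q ^ 2 + p * q - p ^ 2 + 2 * q + 3 * p - 6) ∧ 0 ≤ (q - p + 1) - (-q ^ 2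
    + p * q - p ^ 2 + 2 * q + 3 * p - 6) ∧
    ((p - 2) - (-q ^ 2 + p * q - p ^ 2 + 2 * q + 3 * p - 6)) * ((q - p + 1) - (-q ^ 2 + p * q
    - p ^ 2 + 2 * q + 3 * p - 6)) - ((q - 2) ^ 2 - (q - 2) * ((-q ^ 2 + p * q - p ^ 2 + 2 * q
    + 3 * p - 6)) + ((-q ^ 2 + p * q - p ^ 2 + 2 * q + 3 * p - 6)) ^ 2) = 0 := by
  refine ⟨?_, ?_, ?_⟩
  · rw [h11_at_T_ew_13]; exact normForm_nonneg _ _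
  · rw [h22_at_T_ew_13]; exact normForm_nonneg _ _
  · have h := det_ew_13 p q (-q ^ 2 + p * q - p ^ 2 + 2 * q + 3 * p - 6)
    linear_combination h

/-- (41-L-CLOSED, ew_13) LIVE ⟺ `T > 0`: a feasible point with `m' = t > 0` and `n_a = n_b = T ≥ 0` exists iff `0 < T`. -/
theorem live_iff_ew_13 {F : Type*} [Field F] [LinearOrder F] [IsStrictOrderedRing F] (p q : F) :
    (∃ t : F, 0 < t ∧ 0 ≤ -q ^ 2 + p * q - p ^ 2 + 2 * q + 3 * p - 6 ∧ 0 ≤ p - 2 - t ∧ 0 ≤ q - p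
    + 1 - t ∧ 0 ≤ (p - 2 - t) * (q - p + 1 - t) - ((q - 2) ^ 2 - (q - 2) * (t) + (t) ^ 2)) ↔
    0 < -q ^ 2 + p * q - p ^ 2 + 2 * q + 3 * p - 6 := by
  constructor
  · rintro ⟨t, ht, -, -, -, hdet⟩
    have h := bound_ew_13 p q t hdet
    linarith
  · intro hT
    obtain ⟨h1, h2, h3⟩ := attained_ew_13 p q
    exact ⟨_, hT, hT.le, by linarith, by linarith, h3.ge⟩

/-- (41-L-CLOSED, ew_13) `sup m' = T = (1 - N(s_a - s_b))/3`: every feasible `t` is `≤ T`, and `t = T` is feasible when `0 ≤ T`. -/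
theorem mprime_max_ew_13 {F : Type*} [Field F] [LinearOrder F] [IsStrictOrderedRing F] (p q : F) :
    (∀ t : F, 0 ≤ p - 2 - t → 0 ≤ q - p + 1 - t → 0 ≤ (p - 2 - t) * (q - p + 1 - t) - ((q
    - 2) ^ 2 - (q - 2) * (t) + (t) ^ 2) → t ≤ -q ^ 2 + p * q - p ^ 2 + 2 * q + 3 * p - 6) ∧
    (0 ≤ -q ^ 2 + p * q - p ^ 2 + 2 * q + 3 * p - 6 → ∃ t : F, t = -q ^ 2 + p * q - p ^ 2 + 2 * q
    + 3 * p - 6 ∧ 0 ≤ p - 2 - t ∧ 0 ≤ q - p + 1 - t ∧ 0 ≤ (p - 2 - t) * (q - p + 1 - t) - ((q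
    - 2) ^ 2 - (q - 2) * (t) + (t) ^ 2)) := by
  refine ⟨fun t _ _ hdet => bound_ew_13 p q t hdet, fun _ => ?_⟩
  obtain ⟨h1, h2, h3⟩ := attained_ew_13 p q
  exact ⟨_, rfl, by linarith, by linarith, h3.ge⟩

/-! ## System `ew_2` (τ = ew, pencil 2): `T = -q ^ 2 + p * q - p ^ 2 + 2 * q + 3 * p - 6`, `h11 = q - p + 1 - t`, `h22 = 3 - q - t`, `α = 3 - p`, `β = t`. -/

/-- (41-L-CLOSED, ew_2) `det H̄(t) = h11 h22 - (α² - αβ + β²) = T - t`: linear in `t`. -/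
theorem det_ew_2 (p q t : R) :
    (q - p + 1 - t) * (3 - q - t) - ((3 - p) ^ 2 - (3 - p) * (t) + (t) ^ 2) = (-q ^ 2 + p * q
    - p ^ 2 + 2 * q + 3 * p - 6) - t := by
  ring

/-- (41-L-CLOSED, ew_2) at `t = T`: `h11 = N(s_a - s(f2))`, `s(f2) = 3 + 2 ω` (τ = ew). -/
theorem h11_at_T_ew_2 (p q : R) :
    (q - p + 1) - (-q ^ 2 + p * q - p ^ 2 + 2 * q + 3 * p - 6) = (p - 3) ^ 2 - (p - 3) * (q - 2)
    + (q - 2) ^ 2 := by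
  ring

/-- (41-L-CLOSED, ew_2) at `t = T`: `h22 = N(s_a - s(f1))`, `s(f1) = 3 + 3 ω` (τ = ew). -/
theorem h22_at_T_ew_2 (p q : R) :
    (3 - q) - (-q ^ 2 + p * q - p ^ 2 + 2 * q + 3 * p - 6) = (p - 3) ^ 2 - (p - 3) * (q - 3) + (q
    - 3) ^ 2 := by
  ring

/-- (41-L ↔ 41-EW, ew_2) with `s = p + q ω`, `s̄ = p + q ω²`, `P = 3 s⋆ = 8 + 7 ω`, `v v̄ = 19`: the printed `Ns` is the
coordinate form of `3 s s̄ - P̄ s - P s̄ + v v̄ = ((1-u)s - v)((1-ū)s̄ - v̄)` (`EigenclassPartnerIdentities.normDiff_ew_2`). -/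
theorem Ns_eq_ew_2 (ω p q : R) (hω : ω ^ 2 + ω + 1 = 0) :
    3 * ((p + q * ω) * (p + q * ω ^ 2)) - (8 + 7 * ω ^ 2) * (p + q * ω) - (8 + 7 * ω) * (p
    + q * ω ^ 2) + 19
      = 3 * q ^ 2 - 3 * p * q + 3 * p ^ 2 - 6 * q - 9 * p + 19 := by
  linear_combination (3 * ω * q ^ 2 - 14 * ω * q + 3 * p * q - 3 * q ^ 2 - 7 * p + 6 * q) * hω

/-- (41-L-CLOSED, ew_2) BOUND: every `t` with `det H̄(t) ≥ 0` has `m' = t ≤ T`. -/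
theorem bound_ew_2 {F : Type*} [Field F] [LinearOrder F] [IsStrictOrderedRing F] (p q t : F)
    (hdet : 0 ≤ (q - p + 1 - t) * (3 - q - t) - ((3 - p) ^ 2 - (3 - p) * (t) + (t) ^ 2)) :
    t ≤ -q ^ 2 + p * q - p ^ 2 + 2 * q + 3 * p - 6 := by
  have h := det_ew_2 p q t
  linarith

/-- (41-L-CLOSED, ew_2) ATTAINED: at `t = T`, `h11 ≥ 0`, `h22 ≥ 0` and `det H̄ = 0` (rank-one `H̄`: one sheet class). -/
theorem attained_ew_2 {F : Type*} [Field F] [LinearOrder F] [IsStrictOrderedRing F] (p q : F) :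
    0 ≤ (q - p + 1) - (-q ^ 2 + p * q - p ^ 2 + 2 * q + 3 * p - 6) ∧ 0 ≤ (3 - q) - (-q ^ 2
    + p * q - p ^ 2 + 2 * q + 3 * p - 6) ∧
    ((q - p + 1) - (-q ^ 2 + p * q - p ^ 2 + 2 * q + 3 * p - 6)) * ((3 - q) - (-q ^ 2 + p * q
    - p ^ 2 + 2 * q + 3 * p - 6)) - ((3 - p) ^ 2 - (3 - p) * ((-q ^ 2 + p * q - p ^ 2 + 2 * q
    + 3 * p - 6)) + ((-q ^ 2 + p * q - p ^ 2 + 2 * q + 3 * p - 6)) ^ 2) = 0 := by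
  refine ⟨?_, ?_, ?_⟩
  · rw [h11_at_T_ew_2]; exact normForm_nonneg _ _
  · rw [h22_at_T_ew_2]; exact normForm_nonneg _ _
  · have h := det_ew_2 p q (-q ^ 2 + p * q - p ^ 2 + 2 * q + 3 * p - 6)
    linear_combination h

/-- (41-L-CLOSED, ew_2) LIVE ⟺ `T > 0`: a feasible point with `m' = t > 0` and `n_a = n_b = T ≥ 0` exists iff `0 < T`. -/
theorem live_iff_ew_2 {F : Type*} [Field F] [LinearOrder F] [IsStrictOrderedRing F] (p q : F) :
    (∃ t : F, 0 < t ∧ 0 ≤ -q ^ 2 + p * q - p ^ 2 + 2 * q + 3 * p - 6 ∧ 0 ≤ q - p + 1 - t ∧ 0 ≤ 3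
    - q - t ∧ 0 ≤ (q - p + 1 - t) * (3 - q - t) - ((3 - p) ^ 2 - (3 - p) * (t) + (t) ^ 2)) ↔
    0 < -q ^ 2 + p * q - p ^ 2 + 2 * q + 3 * p - 6 := by
  constructor
  · rintro ⟨t, ht, -, -, -, hdet⟩
    have h := bound_ew_2 p q t hdet
    linarith
  · intro hT
    obtain ⟨h1, h2, h3⟩ := attained_ew_2 p q
    exact ⟨_, hT, hT.le, by linarith, by linarith, h3.ge⟩

/-- (41-L-CLOSED, ew_2) `sup m' = T = (1 - N(s_a - s_b))/3`: every feasible `t` is `≤ T`, and `t = T` is feasible when `0 ≤ T`. -/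
theorem mprime_max_ew_2 {F : Type*} [Field F] [LinearOrder F] [IsStrictOrderedRing F] (p q : F) :
    (∀ t : F, 0 ≤ q - p + 1 - t → 0 ≤ 3 - q - t → 0 ≤ (q - p + 1 - t) * (3 - q - t) - ((3
    - p) ^ 2 - (3 - p) * (t) + (t) ^ 2) → t ≤ -q ^ 2 + p * q - p ^ 2 + 2 * q + 3 * p - 6) ∧
    (0 ≤ -q ^ 2 + p * q - p ^ 2 + 2 * q + 3 * p - 6 → ∃ t : F, t = -q ^ 2 + p * q - p ^ 2 + 2 * q
    + 3 * p - 6 ∧ 0 ≤ q - p + 1 - t ∧ 0 ≤ 3 - q - t ∧ 0 ≤ (q - p + 1 - t) * (3 - q - t) - ((3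
    - p) ^ 2 - (3 - p) * (t) + (t) ^ 2)) := by
  refine ⟨fun t _ _ hdet => bound_ew_2 p q t hdet, fun _ => ?_⟩
  obtain ⟨h1, h2, h3⟩ := attained_ew_2 p q
  exact ⟨_, rfl, by linarith, by linarith, h3.ge⟩

/-! ## System `ew2_13` (τ = ew2, pencils 1 and 3): `T = -q ^ 2 + p * q - p ^ 2 + 4 * q + 3 * p - 12`, `h11 = p - q + 1 - t`, `h22 = 4 - p - t`, `α = 4 - q - t`, `β = -t`. -/

/-- (41-L-CLOSED, ew2_13) `det H̄(t) = h11 h22 - (α² - αβ + β²) = T - t`: linear in `t`. -/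
theorem det_ew2_13 (p q t : R) :
    (p - q + 1 - t) * (4 - p - t) - ((4 - q - t) ^ 2 - (4 - q - t) * (-t) + (-t) ^ 2) = (-q ^ 2
    + p * q - p ^ 2 + 4 * q + 3 * p - 12) - t := by
  ring

/-- (41-L-CLOSED, ew2_13) at `t = T`: `h11 = N(s_a - s(f0))`, `s(f0) = 3 + 4 ω` (τ = ew2). -/
theorem h11_at_T_ew2_13 (p q : R) :
    (p - q + 1) - (-q ^ 2 + p * q - p ^ 2 + 4 * q + 3 * p - 12) = (p - 3) ^ 2 - (p - 3) * (q - 4)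
    + (q - 4) ^ 2 := by
  ring

/-- (41-L-CLOSED, ew2_13) at `t = T`: `h22 = N(s_a - s(f2))`, `s(f2) = 4 + 4 ω` (τ = ew2). -/
theorem h22_at_T_ew2_13 (p q : R) :
    (4 - p) - (-q ^ 2 + p * q - p ^ 2 + 4 * q + 3 * p - 12) = (p - 4) ^ 2 - (p - 4) * (q - 4)
    + (q - 4) ^ 2 := by
  ring

/-- (41-L, τ = ew2) `3 T = 1 - Ns` with `Ns = N(s_a - s_b)` as printed, and `T = 1/3 - N(s_a - s⋆)`, `s⋆ = 10/3 + 11/3 ω`. -/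
theorem T_eq_ew2 (p q : R) :
    3 * (-q ^ 2 + p * q - p ^ 2 + 4 * q + 3 * p - 12) = 1 - (3 * q ^ 2 - 3 * p * q + 3 * p ^ 2
    - 12 * q - 9 * p + 37) := by
  ring

/-- (41-L, τ = ew2) over a field of characteristic ≠ 3: `T = 1/3 - N(s_a - s⋆)` in coordinates. -/
theorem T_eq_third_sub_norm_ew2 {F : Type*} [Field F] [LinearOrder F] [IsStrictOrderedRing F] (p q : F) :
    (-q ^ 2 + p * q - p ^ 2 + 4 * q + 3 * p - 12 : F) = 1 / 3 - ((p - 10 / 3) ^ 2 - (p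
    - 10 / 3) * (q - 11 / 3) + (q - 11 / 3) ^ 2) := by
  have h3 : (3 : F) ≠ 0 := by norm_num
  field_simp
  ring

/-- (41-L ↔ 41-EW, ew2_13) with `s = p + q ω`, `s̄ = p + q ω²`, `P = 3 s⋆ = 10 + 11 ω`, `v v̄ = 37`: the printed `Ns` is the
coordinate form of `3 s s̄ - P̄ s - P s̄ + v v̄ = ((1-u)s - v)((1-ū)s̄ - v̄)` (`EigenclassPartnerIdentities.normDiff_ew2_13`). -/
theorem Ns_eq_ew2_13 (ω p q : R) (hω : ω ^ 2 + ω + 1 = 0) :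
    3 * ((p + q * ω) * (p + q * ω ^ 2)) - (10 + 11 * ω ^ 2) * (p + q * ω) - (10 + 11 * ω) * (p
    + q * ω ^ 2) + 37
      = 3 * q ^ 2 - 3 * p * q + 3 * p ^ 2 - 12 * q - 9 * p + 37 := by
  linear_combination (3 * ω * q ^ 2 - 22 * ω * q + 3 * p * q - 3 * q ^ 2 - 11 * p + 12 * q) * hω

/-- (41-L-CLOSED, ew2_13) BOUND: every `t` with `det H̄(t) ≥ 0` has `m' = t ≤ T`. -/
theorem bound_ew2_13 {F : Type*} [Field F] [LinearOrder F] [IsStrictOrderedRing F] (p q t : F)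
    (hdet : 0 ≤ (p - q + 1 - t) * (4 - p - t) - ((4 - q - t) ^ 2 - (4 - q - t) * (-t) + (-t) ^ 2)) :
    t ≤ -q ^ 2 + p * q - p ^ 2 + 4 * q + 3 * p - 12 := by
  have h := det_ew2_13 p q t
  linarith

/-- (41-L-CLOSED, ew2_13) ATTAINED: at `t = T`, `h11 ≥ 0`, `h22 ≥ 0` and `det H̄ = 0` (rank-one `H̄`: one sheet class). -/
theorem attained_ew2_13 {F : Type*} [Field F] [LinearOrder F] [IsStrictOrderedRing F] (p q : F) :
    0 ≤ (p - q + 1) - (-q ^ 2 + p * q - p ^ 2 + 4 * q + 3 * p - 12) ∧ 0 ≤ (4 - p) - (-q ^ 2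
    + p * q - p ^ 2 + 4 * q + 3 * p - 12) ∧
    ((p - q + 1) - (-q ^ 2 + p * q - p ^ 2 + 4 * q + 3 * p - 12)) * ((4 - p) - (-q ^ 2 + p * q
    - p ^ 2 + 4 * q + 3 * p - 12)) - ((4 - q - (-q ^ 2 + p * q - p ^ 2 + 4 * q + 3 * p - 12)) ^ 2
    - (4 - q - (-q ^ 2 + p * q - p ^ 2 + 4 * q + 3 * p - 12)) * (-(-q ^ 2 + p * q - p ^ 2 + 4 * q
    + 3 * p - 12)) + (-(-q ^ 2 + p * q - p ^ 2 + 4 * q + 3 * p - 12)) ^ 2) = 0 := by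
  refine ⟨?_, ?_, ?_⟩
  · rw [h11_at_T_ew2_13]; exact normForm_nonneg _ _
  · rw [h22_at_T_ew2_13]; exact normForm_nonneg _ _
  · have h := det_ew2_13 p q (-q ^ 2 + p * q - p ^ 2 + 4 * q + 3 * p - 12)
    linear_combination h

/-- (41-L-CLOSED, ew2_13) LIVE ⟺ `T > 0`: a feasible point with `m' = t > 0` and `n_a = n_b = T ≥ 0` exists iff `0 < T`. -/
theorem live_iff_ew2_13 {F : Type*} [Field F] [LinearOrder F] [IsStrictOrderedRing F] (p q : F) :
    (∃ t : F, 0 < t ∧ 0 ≤ -q ^ 2 + p * q - p ^ 2 + 4 * q + 3 * p - 12 ∧ 0 ≤ p - q + 1 - t ∧ 0 ≤ 4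
    - p - t ∧ 0 ≤ (p - q + 1 - t) * (4 - p - t) - ((4 - q - t) ^ 2 - (4 - q - t) * (-t)
    + (-t) ^ 2)) ↔
    0 < -q ^ 2 + p * q - p ^ 2 + 4 * q + 3 * p - 12 := by
  constructor
  · rintro ⟨t, ht, -, -, -, hdet⟩
    have h := bound_ew2_13 p q t hdet
    linarith
  · intro hT
    obtain ⟨h1, h2, h3⟩ := attained_ew2_13 p q
    exact ⟨_, hT, hT.le, by linarith, by linarith, h3.ge⟩

/-- (41-L-CLOSED, ew2_13) `sup m' = T = (1 - N(s_a - s_b))/3`: every feasible `t` is `≤ T`, and `t = T` is feasible when `0 ≤ T`. -/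
theorem mprime_max_ew2_13 {F : Type*} [Field F] [LinearOrder F] [IsStrictOrderedRing F] (p q : F) :
    (∀ t : F, 0 ≤ p - q + 1 - t → 0 ≤ 4 - p - t → 0 ≤ (p - q + 1 - t) * (4 - p - t) - ((4 - q
    - t) ^ 2 - (4 - q - t) * (-t) + (-t) ^ 2) → t ≤ -q ^ 2 + p * q - p ^ 2 + 4 * q + 3 * p - 12) ∧
    (0 ≤ -q ^ 2 + p * q - p ^ 2 + 4 * q + 3 * p - 12 → ∃ t : F, t = -q ^ 2 + p * q - p ^ 2
    + 4 * q + 3 * p - 12 ∧ 0 ≤ p - q + 1 - t ∧ 0 ≤ 4 - p - t ∧ 0 ≤ (p - q + 1 - t) * (4 - p - t)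
    - ((4 - q - t) ^ 2 - (4 - q - t) * (-t) + (-t) ^ 2)) := by
  refine ⟨fun t _ _ hdet => bound_ew2_13 p q t hdet, fun _ => ?_⟩
  obtain ⟨h1, h2, h3⟩ := attained_ew2_13 p q
  exact ⟨_, rfl, by linarith, by linarith, h3.ge⟩

/-! ## System `ew2_2` (τ = ew2, pencil 2): `T = -q ^ 2 + p * q - p ^ 2 + 4 * q + 3 * p - 12`, `h11 = 4 - p - t`, `h22 = q - 3 - t`, `α = q - p - t`, `β = -t`. -/

/-- (41-L-CLOSED, ew2_2) `det H̄(t) = h11 h22 - (α² - αβ + β²) = T - t`: linear in `t`. -/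
theorem det_ew2_2 (p q t : R) :
    (4 - p - t) * (q - 3 - t) - ((q - p - t) ^ 2 - (q - p - t) * (-t) + (-t) ^ 2) = (-q ^ 2
    + p * q - p ^ 2 + 4 * q + 3 * p - 12) - t := by
  ring

/-- (41-L-CLOSED, ew2_2) at `t = T`: `h11 = N(s_a - s(f2))`, `s(f2) = 4 + 4 ω` (τ = ew2). -/
theorem h11_at_T_ew2_2 (p q : R) :
    (4 - p) - (-q ^ 2 + p * q - p ^ 2 + 4 * q + 3 * p - 12) = (p - 4) ^ 2 - (p - 4) * (q - 4)
    + (q - 4) ^ 2 := by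
  ring

/-- (41-L-CLOSED, ew2_2) at `t = T`: `h22 = N(s_a - s(f1))`, `s(f1) = 3 + 3 ω` (τ = ew2). -/
theorem h22_at_T_ew2_2 (p q : R) :
    (q - 3) - (-q ^ 2 + p * q - p ^ 2 + 4 * q + 3 * p - 12) = (p - 3) ^ 2 - (p - 3) * (q - 3)
    + (q - 3) ^ 2 := by
  ring

/-- (41-L ↔ 41-EW, ew2_2) with `s = p + q ω`, `s̄ = p + q ω²`, `P = 3 s⋆ = 10 + 11 ω`, `v v̄ = 37`: the printed `Ns` is the
coordinate form of `3 s s̄ - P̄ s - P s̄ + v v̄ = ((1-u)s - v)((1-ū)s̄ - v̄)` (`EigenclassPartnerIdentities.normDiff_ew2_2`). -/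
theorem Ns_eq_ew2_2 (ω p q : R) (hω : ω ^ 2 + ω + 1 = 0) :
    3 * ((p + q * ω) * (p + q * ω ^ 2)) - (10 + 11 * ω ^ 2) * (p + q * ω) - (10 + 11 * ω) * (p
    + q * ω ^ 2) + 37
      = 3 * q ^ 2 - 3 * p * q + 3 * p ^ 2 - 12 * q - 9 * p + 37 := by
  linear_combination (3 * ω * q ^ 2 - 22 * ω * q + 3 * p * q - 3 * q ^ 2 - 11 * p + 12 * q) * hω

/-- (41-L-CLOSED, ew2_2) BOUND: every `t` with `det H̄(t) ≥ 0` has `m' = t ≤ T`. -/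
theorem bound_ew2_2 {F : Type*} [Field F] [LinearOrder F] [IsStrictOrderedRing F] (p q t : F)
    (hdet : 0 ≤ (4 - p - t) * (q - 3 - t) - ((q - p - t) ^ 2 - (q - p - t) * (-t) + (-t) ^ 2)) :
    t ≤ -q ^ 2 + p * q - p ^ 2 + 4 * q + 3 * p - 12 := by
  have h := det_ew2_2 p q t
  linarith

/-- (41-L-CLOSED, ew2_2) ATTAINED: at `t = T`, `h11 ≥ 0`, `h22 ≥ 0` and `det H̄ = 0` (rank-one `H̄`: one sheet class). -/
theorem attained_ew2_2 {F : Type*} [Field F] [LinearOrder F] [IsStrictOrderedRing F] (p q : F) :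
    0 ≤ (4 - p) - (-q ^ 2 + p * q - p ^ 2 + 4 * q + 3 * p - 12) ∧ 0 ≤ (q - 3) - (-q ^ 2 + p * q
    - p ^ 2 + 4 * q + 3 * p - 12) ∧
    ((4 - p) - (-q ^ 2 + p * q - p ^ 2 + 4 * q + 3 * p - 12)) * ((q - 3) - (-q ^ 2 + p * q
    - p ^ 2 + 4 * q + 3 * p - 12)) - ((q - p - (-q ^ 2 + p * q - p ^ 2 + 4 * q + 3 * p - 12)) ^ 2
    - (q - p - (-q ^ 2 + p * q - p ^ 2 + 4 * q + 3 * p - 12)) * (-(-q ^ 2 + p * q - p ^ 2 + 4 * q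
    + 3 * p - 12)) + (-(-q ^ 2 + p * q - p ^ 2 + 4 * q + 3 * p - 12)) ^ 2) = 0 := by
  refine ⟨?_, ?_, ?_⟩
  · rw [h11_at_T_ew2_2]; exact normForm_nonneg _ _
  · rw [h22_at_T_ew2_2]; exact normForm_nonneg _ _
  · have h := det_ew2_2 p q (-q ^ 2 + p * q - p ^ 2 + 4 * q + 3 * p - 12)
    linear_combination h

/-- (41-L-CLOSED, ew2_2) LIVE ⟺ `T > 0`: a feasible point with `m' = t > 0` and `n_a = n_b = T ≥ 0` exists iff `0 < T`. -/
theorem live_iff_ew2_2 {F : Type*} [Field F] [LinearOrder F] [IsStrictOrderedRing F] (p q : F) :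
    (∃ t : F, 0 < t ∧ 0 ≤ -q ^ 2 + p * q - p ^ 2 + 4 * q + 3 * p - 12 ∧ 0 ≤ 4 - p - t ∧ 0 ≤ q - 3
    - t ∧ 0 ≤ (4 - p - t) * (q - 3 - t) - ((q - p - t) ^ 2 - (q - p - t) * (-t) + (-t) ^ 2)) ↔
    0 < -q ^ 2 + p * q - p ^ 2 + 4 * q + 3 * p - 12 := by
  constructor
  · rintro ⟨t, ht, -, -, -, hdet⟩
    have h := bound_ew2_2 p q t hdet
    linarith
  · intro hT
    obtain ⟨h1, h2, h3⟩ := attained_ew2_2 p q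
    exact ⟨_, hT, hT.le, by linarith, by linarith, h3.ge⟩

/-- (41-L-CLOSED, ew2_2) `sup m' = T = (1 - N(s_a - s_b))/3`: every feasible `t` is `≤ T`, and `t = T` is feasible when `0 ≤ T`. -/
theorem mprime_max_ew2_2 {F : Type*} [Field F] [LinearOrder F] [IsStrictOrderedRing F] (p q : F) :
    (∀ t : F, 0 ≤ 4 - p - t → 0 ≤ q - 3 - t → 0 ≤ (4 - p - t) * (q - 3 - t) - ((q - p - t) ^ 2
    - (q - p - t) * (-t) + (-t) ^ 2) → t ≤ -q ^ 2 + p * q - p ^ 2 + 4 * q + 3 * p - 12) ∧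
    (0 ≤ -q ^ 2 + p * q - p ^ 2 + 4 * q + 3 * p - 12 → ∃ t : F, t = -q ^ 2 + p * q - p ^ 2
    + 4 * q + 3 * p - 12 ∧ 0 ≤ 4 - p - t ∧ 0 ≤ q - 3 - t ∧ 0 ≤ (4 - p - t) * (q - 3 - t) - ((q
    - p - t) ^ 2 - (q - p - t) * (-t) + (-t) ^ 2)) := by
  refine ⟨fun t _ _ hdet => bound_ew2_2 p q t hdet, fun _ => ?_⟩
  obtain ⟨h1, h2, h3⟩ := attained_ew2_2 p q
  exact ⟨_, rfl, by linarith, by linarith, h3.ge⟩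

end Summit.Ventures.HSemireg.EigenclassLiveLaw
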